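import Summits.AtomisticToContinuum.FouriersLaw.Theorems.VanishingNoiseTransferVanishingNoiseBoundNessFlipAsymmetryOfUniformHarris
import Summits.AtomisticToContinuum.FouriersLaw.Theorems.VanishingNoiseTransferVanishingNoiseBoundUniformAsymmetryTransfer

/-!
# Stub S2b `stub_nessFlipAsymmetryLipschitz` of the line `fekete-usc-one-length` (crux
`VanishingNoiseBound`, stmt-AtomisticToContinuum-11976), PROVED

`--supports stmt-AtomisticToContinuum-11976`. The registered stub (AS): for `pinnedChain ω₂ lam β γ`
(all parameters `> 0`), `T > 0`, every length `N` and THE unique deterministic weak steady family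
`μ0`, there are `C` and `δ₁ > 0` with `|∫ h∘flip_i dμ0_δ - ∫ h dμ0_δ| ≤ C|δ|` for all
`0 < |δ| < δ₁`, all sites `i` and all continuous `|h| ≤ e^{θ_δ H}`
(`μ0_δ = μ0 (T+δ/2) (T-δ/2)`, `θ_δ = 1/(2 max(T+δ/2, T-δ/2))`): the flip-odd part of the
non-equilibrium steady state is `O(δ)` in the `e^{θ_δ H}`-weighted dual norm.

Proof (all inputs landed in the sibling `…VanishingNoiseBound*` helper files of the line):

* `N = 0`: no site to flip. `N = 1`: both baths act on the single momentum and the unique weak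
  steady state at `(T+δ/2, T-δ/2)` is the Gibbs measure at the MEAN temperature `T`
  (`pinnedChain_isSteadyState_gibbsMeasure_one`), which is flip-invariant: the flip-odd part
  vanishes identically.
* `N ≥ 2`: `nessFlipAsymmetryLipschitz_of_uniformExpConvergence`
  (`…NessFlipAsymmetryOfUniformHarris.lean`: (AS) ⟸ (UH), through the abstract contraction lever,
  the PROVED almost-invariance (E) of the Gibbs measure at `T` under the kernels at
  `(T+δ/2, T-δ/2)` — `L̂_δ e^{-H/T} + 2γ e^{-H/T} = (γδ/2T²)(p_0² - p_{N-1}²)e^{-H/T}` transported by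
  the weighted Duhamel bound — and `flipAsymmetry_le_of_near_flipInvariant`) fed with
  `uniformExpConvergence_half`: CEHR (2.5) for the flip-free transition kernels at
  `(T+δ/2, T-δ/2)`, `|δ| < T`, with constants UNIFORM in `δ` at the weight `θ = 1/(2T) ≥ θ_δ` —
  the temperature-uniform Lyapunov threshold (`pinnedChain_lintegral_exp_hamiltonian_small_uniform`,
  `Tmax = 3T/2`, `θ Tmax = 3/4 < 1`), the temperature-uniform minorisation
  (`pinnedChain_minorization_uniform`) and Harris' theorem with explicit constants
  (`expConvergence_of_drift_of_minorization`), exactly as in the neighbouring (UEC)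
  `uniformExpConvergence` (there at `θ = 1/(4T)`; the stub's class `e^{θ_δ H}`, `θ_δ ↑ 1/(2T)`,
  forces the larger weight here).

No definitions, no `sorry`.
-/

noncomputable section

namespace Summit.AtomisticToContinuum.FouriersLaw.Theorems.FixedLengthNoiseContinuity

open MeasureTheory ProbabilityTheory Filter Topology Set
open scoped NNReal ENNReal
open Literature.MathematicalPhysics.KineticTheory.HeatConduction
open Literature.Probability.Process

variable {ω₂ lam β γ : ℝ} {N : ℕ}

/-- **Exponential convergence of the flip-free chain with constants uniform near equilibrium, at
the weight `θ = 1/(2T)`.** For `pinnedChain ω₂ lam β γ` (all parameters `> 0`), `N ≥ 2` and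
`T > 0`: with `θ = 1/(2T)` (so `1/(2T) ≤ θ < 1/T`) and `δ₀ = T` there are `C ≥ 0`, `c > 0` such
that for every `|δ| < T`, at the temperatures `(T+δ/2, T-δ/2)`, every invariant probability
measure `μ` of the transition kernels satisfies `|P_t f(z) - μ(f)| ≤ C e^{θH(z)} e^{-ct}` for all
`z`, `t ≥ 0` and continuous `|f| ≤ e^{θH}` — the hypothesis (UH) of
`nessFlipAsymmetryLipschitz_of_uniformExpConvergence`. Adapted verbatim from the neighbouring
`uniformExpConvergence` (`θ = 1/(4T)` there): uniform Lyapunov threshold with `Tmax = 3T/2`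
(`θ Tmax = 3/4 < 1`), uniform minorisation for amplitudes in `[√(γT), √(3γT)]`, Harris with
explicit constants. -/
theorem uniformExpConvergence_half (hω : 0 < ω₂) (hl : 0 < lam) (hβ : 0 < β) (hγ : 0 < γ) (hN : 1 < N)
    {T : ℝ} (hT : 0 < T) :
    ∃ θ δ₀ C c : ℝ, 1 / (2 * T) ≤ θ ∧ θ < 1 / T ∧ 0 < δ₀ ∧ 0 ≤ C ∧ 0 < c ∧
      ∀ δ : ℝ, |δ| < δ₀ →
        ∀ μ : Measure (PhaseSpace N), IsProbabilityMeasure μ →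
          (∀ t : ℝ≥0, μ.bind ((pinnedChain ω₂ lam β γ).transitionKernel N (T + δ / 2) (T - δ / 2) t) = μ) →
          ∀ (z : PhaseSpace N) (t : ℝ≥0) (f : PhaseSpace N → ℝ), Continuous f →
            (∀ y, |f y| ≤ Real.exp (θ * (pinnedChain ω₂ lam β γ).hamiltonian N y)) →
            |∫ y, f y ∂((pinnedChain ω₂ lam β γ).transitionKernel N (T + δ / 2) (T - δ / 2) t z) -
                ∫ y, f y ∂μ| ≤
              C * Real.exp (θ * (pinnedChain ω₂ lam β γ).hamiltonian N z) * Real.exp (-c * t) := by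
  -- adapted from `uniformExpConvergence` (…VanishingNoiseBoundUniformAsymmetryTransfer.lean), `θ = 1/(2T)`
  set P := pinnedChain ω₂ lam β γ with hP
  have hN0 : 0 < N := by omega
  -- the weight and the temperature range
  set θ : ℝ := 1 / (2 * T) with hθ
  have hθ0 : 0 < θ := by positivity
  set Tmax : ℝ := 3 * T / 2 with hTmax
  have hTmax0 : 0 < Tmax := by positivity
  have hθT : θ * Tmax = 3 / 4 := by rw [hθ, hTmax]; field_simp; ring
  have hθ' : θ < 1 / Tmax := by rw [lt_div_iff₀ hTmax0, hθT]; norm_num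
  have hθ1 : θ < 1 / T := by
    rw [hθ]; exact one_div_lt_one_div_of_lt hT (by linarith)
  set Λ : ℝ := θ * γ * (Tmax + Tmax) with hΛ
  have hΛ0 : 0 ≤ Λ := by positivity
  -- (UH2): the uniform Lyapunov threshold at `t⋆ = 1`, and the drift constants `a = 1/2`, `b`
  obtain ⟨E₀, hE₀⟩ := pinnedChain_lintegral_exp_hamiltonian_small_uniform hω hl hβ hγ hN hθ0 hTmax0 hθ'
    one_pos
  set b : ℝ := Real.exp Λ * Real.exp (θ * E₀) with hb
  have hb0 : 0 ≤ b := by positivity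
  -- (UMin): the uniform minorisation on the Harris sublevel set `{e^{θH} ≤ R}`, `R = 8b + 2`
  set Rr : ℝ := (2 * (b / (1 - 1 / 2)) + 1) / (1 - 1 / 2) with hRr
  have hRr0 : 0 < Rr := by rw [hRr]; norm_num; positivity
  set cmin : ℝ := Real.sqrt (2 * γ * (T / 2)) with hcmin
  set cmax : ℝ := Real.sqrt (2 * γ * Tmax) with hcmax
  have hcmin0 : 0 < cmin := Real.sqrt_pos.2 (by positivity)
  have hcle : cmin ≤ cmax := Real.sqrt_le_sqrt (by rw [hTmax]; nlinarith)
  obtain ⟨m, α, hm, hα, hmin⟩ := pinnedChain_minorization_uniform hω hl.le hβ hγ hN0 (Real.log Rr / θ) hcmin0 hcle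
  -- Harris with explicit constants
  obtain ⟨C, c, hC, hc, h25⟩ := expConvergence_of_drift_of_minorization (ω₂ := ω₂) (lam := lam) (β := β)
    (γ := γ) (N := N) hω hl.le hβ hγ hN0 hθ0 (a := 1 / 2) (b := b) (by norm_num) (by norm_num) hb0 hα hm hΛ0
  refine ⟨θ, T, C, c, le_rfl, hθ1, hT, hC.le, hc, fun δ hδ μ hμ hinv z t f hf hfb => ?_⟩
  -- the temperatures `(T+δ/2, T-δ/2)`, `|δ| < T`
  have hδ' := abs_lt.1 hδ
  set T_L : ℝ := T + δ / 2 with hTL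
  set T_R : ℝ := T - δ / 2 with hTR
  have hTL0 : 0 < T_L := by rw [hTL]; linarith
  have hTR0 : 0 < T_R := by rw [hTR]; linarith
  have hTLle : T_L ≤ Tmax := by rw [hTL, hTmax]; linarith
  have hTRle : T_R ≤ Tmax := by rw [hTR, hTmax]; linarith
  have hTLge : T / 2 ≤ T_L := by rw [hTL]; linarith
  have hTRge : T / 2 ≤ T_R := by rw [hTR]; linarith
  have hmax0 : 0 < max T_L T_R := lt_max_of_lt_left hTL0
  have hθ'τ : θ < 1 / max T_L T_R := hθ'.trans_le (one_div_le_one_div_of_le hmax0 (max_le hTLle hTRle))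
  have hΛτ : θ * γ * (T_L + T_R) ≤ Λ :=
    mul_le_mul_of_nonneg_left (add_le_add hTLle hTRle) (by positivity)
  have hamp : ∀ T' : ℝ, T / 2 ≤ T' → T' ≤ Tmax →
      cmin ≤ Real.sqrt (2 * γ * T') ∧ Real.sqrt (2 * γ * T') ≤ cmax := fun T' h1 h2 =>
    ⟨Real.sqrt_le_sqrt (by nlinarith), Real.sqrt_le_sqrt (by nlinarith)⟩
  -- the drift at time `1`
  have hVm : Measurable fun y : PhaseSpace N => ENNReal.ofReal (Real.exp (θ * P.hamiltonian N y)) :=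
    ENNReal.measurable_ofReal.comp (Real.measurable_exp.comp
      ((pinnedChain_continuous_hamiltonian ω₂ lam β γ N).measurable.const_mul _))
  have hdrift : ∀ x : PhaseSpace N,
      ∫⁻ y, ENNReal.ofReal (Real.exp (θ * P.hamiltonian N y)) ∂(P.transitionKernel N T_L T_R 1 x) ≤
        ENNReal.ofReal (1 / 2) * ENNReal.ofReal (Real.exp (θ * P.hamiltonian N x)) + ENNReal.ofReal b := by
    intro x
    by_cases hx : P.hamiltonian N x ≤ E₀
    · refine (lintegral_exp_mul_hamiltonian_pinnedChainSemigroup_le hω hl.le hβ.le hγ.le hN0 hTL0.le hTR0.le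
        hTL0 hTR0 hθ0 hθ'τ 1 x).trans (le_add_left (ENNReal.ofReal_le_ofReal ?_))
      rw [hb, NNReal.coe_one, mul_one]
      exact mul_le_mul (Real.exp_le_exp.2 hΛτ) (Real.exp_le_exp.2 (mul_le_mul_of_nonneg_left hx hθ0.le))
        (Real.exp_pos _).le (Real.exp_pos _).le
    · rw [pinnedChain_lintegral_transitionKernel hω hl.le hβ.le hγ.le N T_L T_R 1 x hVm]
      refine (hE₀ T_L T_R hTL0 hTR0 hTLle hTRle x (le_of_not_ge hx)).trans (le_add_right (le_of_eq ?_))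
      rw [← ENNReal.ofReal_mul (by norm_num)]
      congr 1; ring
  -- the minorisation on `{e^{θH} ≤ R} ⊆ {H ≤ log R / θ}`
  obtain ⟨ν, hν, hνmin⟩ := hmin T_L T_R (hamp T_L hTLge hTLle).1 (hamp T_L hTLge hTLle).2
    (hamp T_R hTRge hTRle).1 (hamp T_R hTRge hTRle).2
  have hmin' : ∃ ν : Measure (PhaseSpace N), IsProbabilityMeasure ν ∧ ∀ x : PhaseSpace N,
      Real.exp (θ * P.hamiltonian N x) ≤ (2 * (b / (1 - 1 / 2)) + 1) / (1 - 1 / 2) →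
        ENNReal.ofReal α • ν ≤ P.transitionKernel N T_L T_R (m : ℝ≥0) x := by
    refine ⟨ν, hν, fun x hx => hνmin x ?_⟩
    rw [le_div_iff₀ hθ0, mul_comm]
    exact (Real.le_log_iff_exp_le hRr0).2 hx
  exact h25 T_L T_R hTL0 hTR0 hθ'τ hΛτ hdrift hmin' μ hμ hinv z t f hf hfb

/-- **Stub S2b · nessFlipAsymmetryLipschitz (AS), PROVED.** For all parameters `> 0`, `T > 0`,
every length `N` and THE unique deterministic weak steady family `μ0`: the flip-odd part of
`μ0 (T+δ/2) (T-δ/2)` is `O(δ)` — there are `C` and `δ₁ > 0` with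
`|∫ h∘flip_i dμ0_δ - ∫ h dμ0_δ| ≤ C|δ|` for all `0 < |δ| < δ₁`, all sites `i` and all continuous
`|h| ≤ e^{θ_δ H}`. `N = 0`: vacuous; `N = 1`: the steady state is the flip-invariant Gibbs measure
at the mean temperature `T` (`C = 0`); `N ≥ 2`: `nessFlipAsymmetryLipschitz_of_uniformExpConvergence`
with `uniformExpConvergence_half`. -/
theorem stub_nessFlipAsymmetryLipschitz :
    ∀ ω₂ lam β γ : ℝ, 0 < ω₂ → 0 < lam → 0 < β → 0 < γ → ∀ T : ℝ, 0 < T → ∀ N : ℕ,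
      ∀ μ0 : ℝ → ℝ → Measure (PhaseSpace N),
        (∀ T_L T_R : ℝ, 0 < T_L → 0 < T_R →
          (pinnedChain ω₂ lam β γ).IsSteadyState N T_L T_R (μ0 T_L T_R) ∧
            ∀ ν : Measure (PhaseSpace N),
              (pinnedChain ω₂ lam β γ).IsSteadyState N T_L T_R ν → ν = μ0 T_L T_R) →
        ∃ C δ₁ : ℝ, 0 < δ₁ ∧ ∀ δ : ℝ, δ ≠ 0 → |δ| < δ₁ →
          ∀ (i : Fin N) (h : PhaseSpace N → ℝ), Continuous h →
            (∀ y, |h y| ≤ Real.exp (1 / max (T + δ / 2) (T - δ / 2) / 2 *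
              (pinnedChain ω₂ lam β γ).hamiltonian N y)) →
            |∫ y, h (momentumFlip i y) ∂(μ0 (T + δ / 2) (T - δ / 2)) -
                ∫ y, h y ∂(μ0 (T + δ / 2) (T - δ / 2))| ≤ C * |δ| := by
  intro ω₂ lam β γ hω hl hβ hγ T hT N μ0 hμ0
  set P := pinnedChain ω₂ lam β γ with hPdef
  rcases Nat.lt_or_ge N 2 with hN2 | hN2
  · interval_cases N
    · -- no site to flip
      exact ⟨0, 1, one_pos, fun δ _ _ i => Fin.elim0 i⟩
    · -- one site: the steady state is the Gibbs measure at the mean temperature `T`, flip-invariant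
      refine ⟨0, T, hT, fun δ _ hδ i h _ _ => ?_⟩
      have h1 := abs_lt.1 hδ
      have hTL : 0 < T + δ / 2 := by linarith
      have hTR : 0 < T - δ / 2 := by linarith
      have hG := pinnedChain_isSteadyState_gibbsMeasure_one hω hl.le hβ.le γ hTL hTR
      rw [← (hμ0 _ _ hTL hTR).2 _ hG,
        integral_comp_momentumFlip (P.measurePreserving_momentumFlip_gibbsMeasure 1 _ i), sub_self,
        abs_zero, zero_mul]
  · exact nessFlipAsymmetryLipschitz_of_uniformExpConvergence hω hl hβ hγ hT μ0 hμ0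
      (uniformExpConvergence_half hω hl hβ hγ hN2 hT)

end Summit.AtomisticToContinuum.FouriersLaw.Theorems.FixedLengthNoiseContinuity

end
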